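import Summits.Parity.GeneralizedHardyLittlewood.Theorems.GreenTaoLevelTwoMNTwoMajorArcSum

/-!
# Route `GreenTaoLevelTwo`, crux `MNTwo` (stmt-Parity-21276), line `birth`, stub `stub_mnVertical`:
# §12 concluded — major-arc locally quadratic phases are orthogonal to Möbius (GT 2008b §12)

Block V6 of the `stub_mnVertical` census, FINAL FORM (B. Green, T. Tao, *Quadratic uniformity of
the Möbius function*, Ann. Inst. Fourier 58 (2008) = arXiv:math/0606087, §12 "Handling the major
arcs": "At this point we set `κ = ε = log^{-C(A+1)} N` … Recalling that `q ≲ 1`, we see that `A'`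
may be chosen so that the right-hand side of (dagger) is `≪ log^{-A} N`.  We have, at long last,
contradicted the supposition that (ortho-targ) is false.").  Stated positively and with the
major-arc parameters explicit: if `φ` is locally quadratic on `B_α(n₀,R)` and MAJOR ARC with height
`Q` — `‖q•φ''(a,b)‖ ≤ K ν(a)ν(b)` for `ν(a), ν(b) < ρ`, with `q, K ≤ Q` and `ρ ≥ 1/Q` — then for
every gauge-Lipschitz weight `0 ≤ ψ ≤ 1` supported in `(N,2N] ∩ B_α(n₀,r₁)` (`r₁ + 2ρ ≤ R`,
`3ρ ≤ R`), `‖Σ_{N<n≤2N} μ(n)ψ(n)e(−φ(n))‖ ≤ C Q^D N / log^A N` with `D = (k+1)(k+3) + 2k + 3`.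
Blocks V4–V5 (§§9–11) are to supply the major-arc hypothesis with `Q = log^{O_A(1)} N` when the sum
is large; together with this file that is Proposition 19 (the hypothesis `hP` of
`…MNTwoSectionEight`, via `…MNTwoPropNineteenGlue`).  Proof: `…MNTwoMajorArcSum` with mesh
`m = ⌈8Q⌉` and `η = 1/(Q² m^{k+2} log^A N)` at saving `A(k+2)`.  Def-free.

* `norm_sum_moebius_major_arc_le` — the statement above.

References: [GreenTao2008QuadraticMobius] arXiv:math/0606087 §12.
-/

noncomputable section

open Finset Real ArithmeticFunction
open scoped ArithmeticFunction.Moebius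

namespace Summit.Parity.GeneralizedHardyLittlewood.GreenTaoLevelTwoMNTwoMajorArcFinal

open Summit.Parity.GeneralizedHardyLittlewood.GreenTaoLevelTwoMNTwoMajorArcSum
  (norm_sum_moebius_major_arc_param_le)

/-- The trivial bound `‖Σ_{N<n≤2N} μ(n)ψ(n)e(−φ(n))‖ ≤ N` for `0 ≤ ψ ≤ 1`. [folklore] -/
theorem norm_sum_trivial (N : ℕ) (ψ : ℤ → ℝ) (hψ0 : ∀ n, 0 ≤ ψ n) (hψ1 : ∀ n, ψ n ≤ 1)
    (φ : ℤ → UnitAddCircle) :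
    ‖∑ n ∈ Ioc N (2 * N), ((μ n : ℝ) : ℂ) * ((ψ n : ℝ) : ℂ) *
        ((AddCircle.toCircle (-φ n) : Circle) : ℂ)‖ ≤ N := by
  calc _ ≤ ∑ n ∈ Ioc N (2 * N), ‖((μ n : ℝ) : ℂ) * ((ψ n : ℝ) : ℂ) *
        ((AddCircle.toCircle (-φ n) : Circle) : ℂ)‖ := norm_sum_le _ _
    _ ≤ ∑ _n ∈ Ioc N (2 * N), (1 : ℝ) := Finset.sum_le_sum fun n _ => by
        rw [norm_mul, norm_mul, Circle.norm_coe, mul_one, Complex.norm_real, Complex.norm_real,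
          Real.norm_eq_abs, Real.norm_eq_abs, abs_of_nonneg (hψ0 n)]
        have h1 : |((μ n : ℝ))| ≤ 1 := by exact_mod_cast abs_moebius_le_one
        have := hψ1 n
        nlinarith [abs_nonneg ((μ n : ℝ))]
    _ = N := by simp [show 2 * N - N = N by omega]

/-- The mass bound `Σ_{N<n≤2N} ψ(n) ≤ N` for `ψ ≤ 1`. [folklore] -/
theorem sum_weight_le (N : ℕ) (ψ : ℤ → ℝ) (hψ1 : ∀ n, ψ n ≤ 1) :
    ∑ n ∈ Ioc N (2 * N), ψ n ≤ N := by
  calc ∑ n ∈ Ioc N (2 * N), ψ n ≤ ∑ _n ∈ Ioc N (2 * N), (1 : ℝ) :=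
        Finset.sum_le_sum fun n _ => hψ1 n
    _ = N := by simp [show 2 * N - N = N by omega]

/-- Bookkeeping for the main term of §12: with `η = 1/(Q² m^{k+2} Λ)`, `m ≤ 9Q`,
`(mᵏ m)·(C₁ q/√((η/16)^{k+1}/2)·N/Λ^{k+2}) ≤ 2·16^{k+1}·9^{(k+1)(k+3)}·C₁·Q^{(k+1)(k+3)+2k+3}·N/Λ`.
[folklore] -/
theorem main_term_bookkeeping (k : ℕ) {C₁ Q mr η Lg Nr qr : ℝ} (hC₁ : 0 ≤ C₁) (hQ : 1 ≤ Q)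
    (hm : 0 < mr) (hmQ : mr ≤ 9 * Q) (hη : 0 < η) (hη1 : η ≤ 1) (hLg : 0 < Lg)
    (hηdef : η = 1 / (Q ^ 2 * mr ^ (k + 2) * Lg)) (hN : 0 ≤ Nr) (hqQ : qr ≤ Q) :
    (mr ^ k * mr) * (C₁ * qr / Real.sqrt ((η / 16) ^ (k + 1) / 2) * Nr / Lg ^ (k + 2)) ≤
      2 * 16 ^ (k + 1) * 9 ^ ((k + 1) * (k + 3)) * C₁ * Q ^ ((k + 1) * (k + 3) + 2 * k + 3) *
        Nr / Lg := by
  have hδpos : 0 < (η / 16) ^ (k + 1) / 2 := by positivity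
  have hδ1 : (η / 16) ^ (k + 1) / 2 ≤ 1 := by
    have : (η / 16) ^ (k + 1) ≤ 1 := pow_le_one₀ (by positivity) (by linarith)
    linarith
  have hsqrt : (η / 16) ^ (k + 1) / 2 ≤ Real.sqrt ((η / 16) ^ (k + 1) / 2) := by
    have h := Real.sqrt_le_sqrt hδ1
    rw [Real.sqrt_one] at h
    calc (η / 16) ^ (k + 1) / 2
        = Real.sqrt ((η / 16) ^ (k + 1) / 2) * Real.sqrt ((η / 16) ^ (k + 1) / 2) :=
          (Real.mul_self_sqrt hδpos.le).symm
      _ ≤ Real.sqrt ((η / 16) ^ (k + 1) / 2) * 1 :=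
          mul_le_mul_of_nonneg_left h (Real.sqrt_nonneg _)
      _ = _ := mul_one _
  have hQ0 : Q ≠ 0 := by positivity
  have hm0 : mr ≠ 0 := hm.ne'
  have hLg0 : Lg ≠ 0 := hLg.ne'
  have hη0 : η ≠ 0 := hη.ne'
  have hinvη : 1 / η = Q ^ 2 * mr ^ (k + 2) * Lg := by rw [hηdef, one_div_one_div]
  have hinvδ : 1 / ((η / 16) ^ (k + 1) / 2) = 2 * 16 ^ (k + 1) * (Q ^ 2 * mr ^ (k + 2) * Lg) ^ (k + 1) := by
    rw [← hinvη]
    field_simp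
    rw [← mul_pow, ← mul_pow, show η / 16 * 16 * (1 / η) = 1 by field_simp, one_pow]
  have hLgk2 : 0 < Lg ^ (k + 2) := by positivity
  have step1 : C₁ * qr / Real.sqrt ((η / 16) ^ (k + 1) / 2) * Nr / Lg ^ (k + 2) ≤
      C₁ * Q * (1 / ((η / 16) ^ (k + 1) / 2)) * Nr / Lg ^ (k + 2) := by
    rw [div_le_div_iff_of_pos_right hLgk2]
    have h1 : C₁ * qr / Real.sqrt ((η / 16) ^ (k + 1) / 2) ≤ C₁ * Q * (1 / ((η / 16) ^ (k + 1) / 2)) := by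
      rw [div_eq_mul_one_div]
      exact mul_le_mul (mul_le_mul_of_nonneg_left hqQ hC₁)
        (one_div_le_one_div_of_le hδpos hsqrt) (by positivity) (by positivity)
    exact mul_le_mul_of_nonneg_right h1 hN
  refine (mul_le_mul_of_nonneg_left step1 (by positivity)).trans ?_
  rw [hinvδ]
  have e : (mr ^ k * mr) * (C₁ * Q * (2 * 16 ^ (k + 1) * (Q ^ 2 * mr ^ (k + 2) * Lg) ^ (k + 1))
      * Nr / Lg ^ (k + 2)) =
      2 * 16 ^ (k + 1) * C₁ * (Q ^ (2 * k + 3) * mr ^ ((k + 1) * (k + 3))) * Nr / Lg := by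
    have hLgne : Lg ≠ 0 := hLg.ne'
    field_simp
    ring
  rw [e, div_le_div_iff_of_pos_right hLg]
  have hmpow : mr ^ ((k + 1) * (k + 3)) ≤ (9 * Q) ^ ((k + 1) * (k + 3)) :=
    pow_le_pow_left₀ hm.le hmQ _
  have hQpow : Q ^ (2 * k + 3) * (9 * Q) ^ ((k + 1) * (k + 3)) =
      9 ^ ((k + 1) * (k + 3)) * Q ^ ((k + 1) * (k + 3) + 2 * k + 3) := by rw [mul_pow]; ring
  have h5 : Q ^ (2 * k + 3) * mr ^ ((k + 1) * (k + 3)) ≤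
      9 ^ ((k + 1) * (k + 3)) * Q ^ ((k + 1) * (k + 3) + 2 * k + 3) := by
    rw [← hQpow]; exact mul_le_mul_of_nonneg_left hmpow (by positivity)
  have h6 : 0 ≤ 2 * 16 ^ (k + 1) * C₁ := by positivity
  calc 2 * 16 ^ (k + 1) * C₁ * (Q ^ (2 * k + 3) * mr ^ ((k + 1) * (k + 3))) * Nr
      ≤ 2 * 16 ^ (k + 1) * C₁ * (9 ^ ((k + 1) * (k + 3)) * Q ^ ((k + 1) * (k + 3) + 2 * k + 3)) * Nr :=
        mul_le_mul_of_nonneg_right (mul_le_mul_of_nonneg_left h5 h6) hN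
    _ = _ := by ring

/-- Bookkeeping of the constants. [folklore] -/
theorem const_bookkeeping (k : ℕ) (C₁ : ℝ) {Q : ℝ} (hQ : 1 ≤ Q) :
    2 * 16 ^ (k + 1) * 9 ^ ((k + 1) * (k + 3)) * C₁ * Q ^ ((k + 1) * (k + 3) + 2 * k + 3) +
        2 * (k + 2) + 6 * Real.pi ≤
      (2 * 16 ^ (k + 1) * 9 ^ ((k + 1) * (k + 3)) * C₁ + 2 * (k + 2) + 6 * Real.pi + 1) *
        Q ^ ((k + 1) * (k + 3) + 2 * k + 3) := by
  have hQD : 1 ≤ Q ^ ((k + 1) * (k + 3) + 2 * k + 3) := one_le_pow₀ hQ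
  have ha0 : (0 : ℝ) ≤ 2 * (k + 2) + 6 * Real.pi + 1 := by positivity
  have h7 : 2 * ((k : ℝ) + 2) + 6 * Real.pi ≤
      (2 * (k + 2) + 6 * Real.pi + 1) * Q ^ ((k + 1) * (k + 3) + 2 * k + 3) :=
    calc 2 * ((k : ℝ) + 2) + 6 * Real.pi ≤ 2 * (k + 2) + 6 * Real.pi + 1 := by linarith
      _ ≤ (2 * (k + 2) + 6 * Real.pi + 1) * Q ^ ((k + 1) * (k + 3) + 2 * k + 3) :=
          le_mul_of_one_le_right ha0 hQD
  have e2 : (2 * 16 ^ (k + 1) * 9 ^ ((k + 1) * (k + 3)) * C₁ + 2 * ((k : ℝ) + 2) + 6 * Real.pi + 1) *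
      Q ^ ((k + 1) * (k + 3) + 2 * k + 3) =
      2 * 16 ^ (k + 1) * 9 ^ ((k + 1) * (k + 3)) * C₁ * Q ^ ((k + 1) * (k + 3) + 2 * k + 3) +
        (2 * (k + 2) + 6 * Real.pi + 1) * Q ^ ((k + 1) * (k + 3) + 2 * k + 3) := by ring
  rw [e2]
  linarith

set_option maxHeartbeats 400000 in
/-- **Major-arc locally quadratic phases are orthogonal to Möbius (GT 2008b §12).**  For every
`k` and `A > 0` there is `C ≥ 0` such that, with `D = (k+1)(k+3) + 2k + 3`: for `N ≥ 2`, a rotation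
`α ∈ ℝᵏ`, a phase `φ : ℤ → ℝ/ℤ` locally quadratic on the Bohr ball `B_α(n₀, R)` (gauge
`ν(n) = ⨆ᵢ‖nαᵢ‖ + |n|/N`) and major arc of height `Q ≥ 1` (`‖q•φ''(a,b)‖ ≤ Kν(a)ν(b)` for
`ν a, ν b < ρ`, with `1 ≤ q ≤ Q`, `0 ≤ K ≤ Q`, `1/Q ≤ ρ`, `r₁ + 2ρ ≤ R`, `3ρ ≤ R`), and a weight
`0 ≤ ψ ≤ 1` supported in `(N,2N] ∩ B_α(n₀,r₁)` with `|ψ(n) − ψ(n')| ≤ ν(n − n')`: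
`‖Σ_{N<n≤2N} μ(n)ψ(n)e(−φ(n))‖ ≤ C Q^D N / log^A N`.
[cite: GreenTao2008QuadraticMobius, §12] -/
theorem norm_sum_moebius_major_arc_le (k : ℕ) {A : ℝ} (hA : 0 < A) :
    ∃ C : ℝ, 0 ≤ C ∧ ∀ N : ℕ, 2 ≤ N → ∀ (α : Fin k → ℝ) (n₀ : ℤ) (R K ρ r₁ Q : ℝ) (q : ℕ)
      (φ : ℤ → UnitAddCircle) (ψ : ℤ → ℝ),
      (∀ n u b c : ℤ,
        (⨆ i : Fin k, ‖((((n - n₀ : ℤ) : ℝ) * α i : ℝ) : AddCircle (1 : ℝ))‖) +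
            |((n - n₀ : ℤ) : ℝ)| / N < R →
        (⨆ i : Fin k, ‖((((n + u - n₀ : ℤ) : ℝ) * α i : ℝ) : AddCircle (1 : ℝ))‖) +
            |((n + u - n₀ : ℤ) : ℝ)| / N < R →
        (⨆ i : Fin k, ‖((((n + b - n₀ : ℤ) : ℝ) * α i : ℝ) : AddCircle (1 : ℝ))‖) +
            |((n + b - n₀ : ℤ) : ℝ)| / N < R →
        (⨆ i : Fin k, ‖((((n + c - n₀ : ℤ) : ℝ) * α i : ℝ) : AddCircle (1 : ℝ))‖) +
            |((n + c - n₀ : ℤ) : ℝ)| / N < R →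
        (⨆ i : Fin k, ‖((((n + u + b - n₀ : ℤ) : ℝ) * α i : ℝ) : AddCircle (1 : ℝ))‖) +
            |((n + u + b - n₀ : ℤ) : ℝ)| / N < R →
        (⨆ i : Fin k, ‖((((n + u + c - n₀ : ℤ) : ℝ) * α i : ℝ) : AddCircle (1 : ℝ))‖) +
            |((n + u + c - n₀ : ℤ) : ℝ)| / N < R →
        (⨆ i : Fin k, ‖((((n + b + c - n₀ : ℤ) : ℝ) * α i : ℝ) : AddCircle (1 : ℝ))‖) +
            |((n + b + c - n₀ : ℤ) : ℝ)| / N < R →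
        (⨆ i : Fin k, ‖((((n + u + b + c - n₀ : ℤ) : ℝ) * α i : ℝ) : AddCircle (1 : ℝ))‖) +
            |((n + u + b + c - n₀ : ℤ) : ℝ)| / N < R →
        φ (n + u + b + c) - φ (n + u + b) - φ (n + u + c) - φ (n + b + c)
          + φ (n + u) + φ (n + b) + φ (n + c) - φ n = 0) →
      1 ≤ q → 0 ≤ K → 1 ≤ Q → (q : ℝ) ≤ Q → K ≤ Q → 1 / Q ≤ ρ → r₁ + 2 * ρ ≤ R → 3 * ρ ≤ R →
      (∀ u b : ℤ,
        (⨆ i : Fin k, ‖(((u : ℝ) * α i : ℝ) : AddCircle (1 : ℝ))‖) + |(u : ℝ)| / N < ρ →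
        (⨆ i : Fin k, ‖(((b : ℝ) * α i : ℝ) : AddCircle (1 : ℝ))‖) + |(b : ℝ)| / N < ρ →
        ‖q • (φ (n₀ + u + b) - φ (n₀ + u) - φ (n₀ + b) + φ n₀)‖ ≤
          K * ((⨆ i : Fin k, ‖(((u : ℝ) * α i : ℝ) : AddCircle (1 : ℝ))‖) + |(u : ℝ)| / N) *
            ((⨆ i : Fin k, ‖(((b : ℝ) * α i : ℝ) : AddCircle (1 : ℝ))‖) + |(b : ℝ)| / N)) →
      (∀ n, 0 ≤ ψ n) → (∀ n, ψ n ≤ 1) → (∀ n, ψ n ≠ 0 → (N : ℤ) < n ∧ n ≤ 2 * N) →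
      (∀ n, ψ n ≠ 0 →
        (⨆ i : Fin k, ‖((((n - n₀ : ℤ) : ℝ) * α i : ℝ) : AddCircle (1 : ℝ))‖) +
          |((n - n₀ : ℤ) : ℝ)| / N < r₁) →
      (∀ n n' : ℤ, |ψ n - ψ n'| ≤
        (⨆ i : Fin k, ‖((((n - n' : ℤ) : ℝ) * α i : ℝ) : AddCircle (1 : ℝ))‖) +
          |((n - n' : ℤ) : ℝ)| / N) →
      ‖∑ n ∈ Ioc N (2 * N), ((μ n : ℝ) : ℂ) * ((ψ n : ℝ) : ℂ) *
          ((AddCircle.toCircle (-φ n) : Circle) : ℂ)‖ ≤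
        C * Q ^ ((k + 1) * (k + 3) + 2 * k + 3) * N / Real.log N ^ A := by
  have hA' : 0 < A * (k + 2) := by positivity
  obtain ⟨C₁, hC₁0, hC₁⟩ := norm_sum_moebius_major_arc_param_le k hA'
  -- the constant
  set C : ℝ := 2 * 16 ^ (k + 1) * 9 ^ ((k + 1) * (k + 3)) * C₁ + 2 * (k + 2) + 6 * Real.pi + 1 with hC
  have hCpos : 1 ≤ C := by
    have : 0 ≤ 2 * 16 ^ (k + 1) * 9 ^ ((k + 1) * (k + 3)) * C₁ + 2 * ((k : ℝ) + 2) + 6 * Real.pi := by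
      positivity
    rw [hC]; linarith
  refine ⟨C, by linarith, ?_⟩
  intro N hN α n₀ R K ρ r₁ Q q φ ψ hφ hq hK hQ hqQ hKQ hQρ hR hρR hMA hψ0 hψ1 hsupp hloc hlip
  have hNr : (0 : ℝ) < N := by exact_mod_cast (show 0 < N by omega)
  have hlogpos : 0 < Real.log N := Real.log_pos (by exact_mod_cast (show 1 < N by omega))
  set Lg : ℝ := Real.log N ^ A with hLg
  have hLgpos : 0 < Lg := Real.rpow_pos_of_pos hlogpos A
  have hQD : 1 ≤ Q ^ ((k + 1) * (k + 3) + 2 * k + 3) := one_le_pow₀ hQ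
  have htriv := norm_sum_trivial N ψ hψ0 hψ1 φ
  -- Case `log N ≤ 1`: the trivial bound suffices
  by_cases hsmall : Real.log N ≤ 1
  · have hLg1 : Lg ≤ 1 := Real.rpow_le_one hlogpos.le hsmall hA.le
    refine htriv.trans ?_
    rw [le_div_iff₀ hLgpos]
    have h1 : (N : ℝ) * Lg ≤ N := by nlinarith
    have h2 : (N : ℝ) ≤ C * Q ^ ((k + 1) * (k + 3) + 2 * k + 3) * N := by
      have : (1 : ℝ) ≤ C * Q ^ ((k + 1) * (k + 3) + 2 * k + 3) := by nlinarith
      nlinarith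
    linarith
  push Not at hsmall
  have hLg1 : 1 < Lg := Real.one_lt_rpow hsmall hA
  -- parameters
  set m : ℕ := ⌈8 * Q⌉₊ with hmdef
  have hm8 : 8 * Q ≤ m := Nat.le_ceil _
  have hmQ : (m : ℝ) ≤ 9 * Q := by
    have : (m : ℝ) < 8 * Q + 1 := Nat.ceil_lt_add_one (by positivity); linarith
  have hm2 : 2 ≤ m := by
    have : (2 : ℝ) ≤ m := by linarith
    exact_mod_cast this
  have hmr : (0 : ℝ) < m := by linarith
  have hm1r : (1 : ℝ) ≤ m := by linarith
  set η : ℝ := 1 / (Q ^ 2 * (m : ℝ) ^ (k + 2) * Lg) with hηdef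
  have hden : 0 < Q ^ 2 * (m : ℝ) ^ (k + 2) * Lg := by positivity
  have hη : 0 < η := by rw [hηdef]; positivity
  have hmk1 : (1 : ℝ) ≤ (m : ℝ) ^ (k + 2) := one_le_pow₀ hm1r
  have hηQ2 : η * Q ^ 2 ≤ 1 := by
    rw [hηdef, div_mul_eq_mul_div, one_mul, div_le_one hden]
    have hQ2 : 0 ≤ Q ^ 2 := by positivity
    nlinarith [mul_le_mul_of_nonneg_left hmk1 hQ2]
  have hη1 : η ≤ 1 := by nlinarith [one_le_pow₀ hQ (n := 2)]
  have hqη1 : (q : ℝ) * η ≤ 1 / Q := by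
    rw [le_div_iff₀ (by positivity)]
    calc (q : ℝ) * η * Q ≤ Q * η * Q := by gcongr
      _ = η * Q ^ 2 := by ring
      _ ≤ 1 := hηQ2
  have hqηρ : (q : ℝ) * η ≤ ρ := hqη1.trans hQρ
  have hqη1' : (q : ℝ) * η ≤ 1 := hqη1.trans (by rw [div_le_one (by positivity)]; exact hQ)
  have h8m : (8 : ℝ) / m ≤ ρ := by
    refine le_trans ?_ hQρ
    rw [div_le_div_iff₀ hmr (by positivity)]; linarith
  -- the parametric estimate at saving `A(k+2)`
  have main := hC₁ N hN α n₀ R K ρ r₁ η q m φ ψ hφ hq hK hη hη1 hqηρ hqη1' hm2 h8m hR hρR hMA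
    hψ0 hψ1 hsupp hloc hlip
  have hLgk : Real.log N ^ (A * (k + 2)) = Lg ^ (k + 2) := by
    rw [hLg, ← Real.rpow_mul_natCast hlogpos.le]; norm_cast
  rw [hLgk] at main
  clear hC₁ hφ hMA hloc hlip hsupp htriv
  refine main.trans ?_
  -- bookkeeping of the three terms
  have hmass := sum_weight_le N ψ hψ1
  have hmass0 : 0 ≤ ∑ n ∈ Ioc N (2 * N), ψ n := Finset.sum_nonneg fun n _ => hψ0 n
  -- (iii) the shift-error term
  have hT2 : ((m : ℝ) ^ k * m) * (N * ((1 + k * m + m) * (2 * q * η))) ≤ 2 * (k + 2) * N / Lg := by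
    have h1 : (1 : ℝ) + k * m + m ≤ (k + 2) * m := by nlinarith
    have h2 : ((m : ℝ) ^ k * m) * (N * ((1 + k * m + m) * (2 * q * η))) ≤
        ((m : ℝ) ^ k * m) * (N * (((k + 2) * m) * (2 * Q * η))) := by
      gcongr
    refine h2.trans ?_
    have e : ((m : ℝ) ^ k * m) * (N * (((k + 2) * m) * (2 * Q * η))) =
        2 * (k + 2) * N * (Q * (m : ℝ) ^ (k + 2) * η) := by ring
    rw [e, le_div_iff₀ hLgpos]
    have h3 : Q * (m : ℝ) ^ (k + 2) * η * Lg = 1 / Q := by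
      rw [hηdef]; field_simp
    have h4 : 1 / Q ≤ 1 := by rw [div_le_one (by positivity)]; exact hQ
    calc 2 * (k + 2) * N * (Q * (m : ℝ) ^ (k + 2) * η) * Lg
        = 2 * (k + 2) * N * (Q * (m : ℝ) ^ (k + 2) * η * Lg) := by ring
      _ ≤ 2 * (k + 2) * N * 1 := by rw [h3]; gcongr
      _ = 2 * (k + 2) * N := by ring
  -- (ii) the linearity-error term
  have hT3 : 2 * Real.pi * (K * η * (q * η + 4 * (4 / m))) * ∑ n ∈ Ioc N (2 * N), ψ n ≤
      6 * Real.pi * N / Lg := by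
    have h16 : 4 * (4 / (m : ℝ)) ≤ 2 := by
      rw [show (4 : ℝ) * (4 / m) = 16 / m by ring, div_le_iff₀ hmr]
      have : (8 : ℝ) ≤ m := by linarith
      linarith
    have h1 : (q : ℝ) * η + 4 * (4 / m) ≤ 3 := by linarith
    have h2 : K * η * (q * η + 4 * (4 / m)) ≤ Q * η * 3 := by
      have : 0 ≤ (q : ℝ) * η + 4 * (4 / m) := by positivity
      calc K * η * (q * η + 4 * (4 / m)) ≤ Q * η * (q * η + 4 * (4 / m)) := by gcongr
        _ ≤ Q * η * 3 := by gcongr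
    have h3 : Q * η ≤ 1 / Lg := by
      rw [hηdef, mul_one_div, div_le_div_iff₀ hden hLgpos]
      have hQ1 : Q ≤ Q ^ 2 := by rw [sq]; exact le_mul_of_one_le_left (by positivity) hQ
      have h5 : Q ≤ Q ^ 2 * (m : ℝ) ^ (k + 2) := hQ1.trans (le_mul_of_one_le_right (by positivity) hmk1)
      rw [one_mul]
      exact mul_le_mul_of_nonneg_right h5 hLgpos.le
    have h4 : 2 * Real.pi * (K * η * (q * η + 4 * (4 / m))) ≤ 2 * Real.pi * (Q * η * 3) :=
      mul_le_mul_of_nonneg_left h2 (by positivity)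
    have h4' : 0 ≤ 2 * Real.pi * (Q * η * 3) := by positivity
    calc 2 * Real.pi * (K * η * (q * η + 4 * (4 / m))) * ∑ n ∈ Ioc N (2 * N), ψ n
        ≤ 2 * Real.pi * (Q * η * 3) * N := mul_le_mul h4 hmass hmass0 h4'
      _ = 6 * Real.pi * N * (Q * η) := by ring
      _ ≤ 6 * Real.pi * N * (1 / Lg) := mul_le_mul_of_nonneg_left h3 (by positivity)
      _ = 6 * Real.pi * N / Lg := by ring
  -- (i) the main term
  have hT1 : ((m : ℝ) ^ k * m) * (C₁ * q / Real.sqrt ((η / 16) ^ (k + 1) / 2) * N / Lg ^ (k + 2)) ≤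
      2 * 16 ^ (k + 1) * 9 ^ ((k + 1) * (k + 3)) * C₁ * Q ^ ((k + 1) * (k + 3) + 2 * k + 3) * N / Lg :=
    main_term_bookkeeping k hC₁0 hQ hmr hmQ hη hη1 hLgpos hηdef hNr.le hqQ
  -- assemble
  have hsum : ((m : ℝ) ^ k * m) * (C₁ * q / Real.sqrt ((η / 16) ^ (k + 1) / 2) * N / Lg ^ (k + 2) +
        N * ((1 + k * m + m) * (2 * q * η))) +
      2 * Real.pi * (K * η * (q * η + 4 * (4 / m))) * ∑ n ∈ Ioc N (2 * N), ψ n ≤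
      (2 * 16 ^ (k + 1) * 9 ^ ((k + 1) * (k + 3)) * C₁ * Q ^ ((k + 1) * (k + 3) + 2 * k + 3) +
        2 * (k + 2) + 6 * Real.pi) * N / Lg := by
    rw [mul_add]
    have := add_le_add (add_le_add hT1 hT2) hT3
    refine this.trans (le_of_eq ?_)
    ring
  refine hsum.trans ?_
  rw [div_le_div_iff_of_pos_right hLgpos]
  exact mul_le_mul_of_nonneg_right (const_bookkeeping k C₁ hQ) hNr.le

end Summit.Parity.GeneralizedHardyLittlewood.GreenTaoLevelTwoMNTwoMajorArcFinal
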